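import Summits.RiemannHypothesis.RiemannHypothesis.Theorems.JensenPolynomialsEffectiveKimLee
import Summits.RiemannHypothesis.RiemannHypothesis.Theorems.JensenPolynomialsEffectiveKimLeeFloor
import Summits.RiemannHypothesis.RiemannHypothesis.Theorems.JensenPolynomialsChainDefs
import Literature.Barriers.RiemannHypothesis.JensenPolynomialsKimProofs
import Literature.Analysis.Complex.LaguerrePolya
import Literature.Analysis.Complex.JensenCircles
import HarnessLib

/-!
# Realness climbs the derivative ladder of `ξ₁` (I): the transfer principle and EDGE ⇐ BAND (RH-FREE)

Cell rh-jensen, LADDER-RH rung J-P(P3) «log band» (route JensenLogBand); bears_on: J-P(P3) cruxes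
`XiDerivEdgeReal` (stmt-RiemannHypothesis-19912) and `XiDerivBandRealAllRates` (stmt-…-19913); seat
rh-jensen-idea-2 g7 (negation-construct lens, round 7). RH-FREE throughout; ROUTE-INDEPENDENT module
(no `Theses` import — the route-vocabulary corollaries live in `…Theorems.JensenLogBandOneCrux`).
WHAT THIS IS NOT: nothing here bears on the zeros of `ζ` or the truth of RH, and nothing here proves
any realness by itself — these are structural REDUCTIONS about the Jensen-chain geometry of the real
entire function `ξ₁ = xiSq` of order `< 2`.

## 1. The transfer principle

Read the backward Jensen chain of Ki–Kim (tree: `exists_jensen_chain`, `chain_variation_le`) at an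
INTERMEDIATE level: a zero `w` of `ξ₁⁽ⁿ⁾` with `Im w ≠ 0` has, for EVERY `k ≤ n`, an ancestor `v` —
a zero of `ξ₁⁽ᵏ⁾` with `Im v ≠ 0` — within `‖v − w‖ ≤ Δ := (1 + √n)(1 + √n + √‖w‖)`
(`exists_nonreal_ancestor`). For `‖w‖ ≫ n` the fuzz `Δ` is `o(‖w‖)`: NON-REALNESS PROPAGATES DOWN
the derivative order at (essentially) fixed modulus, i.e. REALNESS PROPAGATES UP — if for some `k ≤ n`
all zeros of `ξ₁⁽ᵏ⁾` with modulus in `[‖w‖ − Δ, ‖w‖ + Δ]` are real, then `w` is real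
(`im_eq_zero_of_level_real`).

## 2. EDGE ⇐ BAND at any single rate (`edgeReal_of_bandReal`)

A non-real zero of `ξ₁⁽ⁿ⁾` in the edge annulus `(n/log n)²/64 ≤ ‖z‖ ≤ 64(n/log n)²` would have a
non-real ancestor at level `k = ⌈3 log n/c⌉` with modulus in `[‖z‖ − Δ₀, ‖z‖ + Δ₀] ⊆ [64k², n³)
⊆ [64(k/log k)², e^{ck})`, `Δ₀ = (1+√n)(1+√n+8n)` — inside the BAND zone of level `k` (at arc ratio
`h/T ≈ 1/100`: no two-saddle coalescence is ever met). So the BAND at ANY ONE rate `c > 0` from some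
level on implies the EDGE from some level on.

(The second reduction, BAND ⇐ TOP SHELL, is `…Theorems.JensenLogBandBandOfShell`, built on this file.)
-/

set_option linter.dupNamespace false

noncomputable section

open Complex Filter Metric Set Topology
open scoped ComplexConjugate

namespace Summit.RiemannHypothesis.RiemannHypothesis.Theorems.JensenPolynomials.LogBand.RealnessLadder

open Literature.NumberTheory.LFunctions Literature.Analysis.Complex
  Literature.Barriers.RiemannHypothesis
  Summit.RiemannHypothesis.RiemannHypothesis.Theorems.JensenPolynomials
  Summit.RiemannHypothesis.RiemannHypothesis.Theorems.JensenPolynomials.EffectiveKimLee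

/-! ### 1. Ancestors at every intermediate level -/

/-- **Ancestor at level `k` (upper half-plane).** A zero `w` of `ξ₁⁽ⁿ⁾` with `Im w > 0` has, for every
`k ≤ n`, an ancestor zero `v` of `ξ₁⁽ᵏ⁾` with `Im v > 0` and `‖v − w‖ ≤ (1 + √n)(1 + √n + √‖w‖)`.
(Ki–Kim backward Jensen chain read at level `k`; tree `exists_jensen_chain`, `chain_variation_le`,
`abs_im_le_sqrt_norm_of_xiSq_eq_zero`.) RH-FREE. -/
theorem exists_ancestor_of_im_pos (n k : ℕ) (hk : k ≤ n) {w : ℂ}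
    (hw : iteratedDeriv n xiSq w = 0) (him : 0 < w.im) :
    ∃ v : ℂ, iteratedDeriv k xiSq v = 0 ∧ 0 < v.im ∧
      ‖v - w‖ ≤ (1 + Real.sqrt n) * (1 + Real.sqrt n + Real.sqrt ‖w‖) := by
  obtain ⟨C, hC⟩ := norm_xiSq_le
  obtain ⟨z, hzn, hzero, hpos, hrel⟩ := exists_jensen_chain differentiable_xiSq
    (by norm_num : (0 : ℝ) ≤ 7 / 8) (by norm_num : (7 / 8 : ℝ) < 2) hC im_xiSq_ofReal
    iteratedDeriv_xiSq_ne_zero n him hw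
  set s : ℝ := 1 + Real.sqrt n with hs
  have hs0 : 0 ≤ s := by have := Real.sqrt_nonneg (n : ℝ); rw [hs]; linarith
  set V : ℝ := ∑ j ∈ Finset.range n, ‖z j - z (j + 1)‖ with hV
  have hVle : V ≤ (z 0).im * (1 + Real.sqrt n) := chain_variation_le hpos hrel
  -- every chain element is within `V` of `w = z n`
  have hdist : ∀ j ≤ n, ‖z j - w‖ ≤ V := by
    intro j hj
    have h := dist_le_Ico_sum_dist z hj
    rw [dist_eq_norm, hzn] at h
    refine h.trans ?_
    calc ∑ i ∈ Finset.Ico j n, dist (z i) (z (i + 1))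
        ≤ ∑ i ∈ Finset.range n, dist (z i) (z (i + 1)) :=
          Finset.sum_le_sum_of_subset_of_nonneg
            (by rw [Finset.range_eq_Ico]; exact Finset.Ico_subset_Ico (Nat.zero_le _) le_rfl)
            (fun _ _ _ => dist_nonneg)
      _ = V := by simp only [hV, dist_eq_norm]
  have hnorm0 : ‖z 0‖ ≤ ‖w‖ + V := by
    calc ‖z 0‖ = ‖(z 0 - w) + w‖ := by rw [sub_add_cancel]
      _ ≤ ‖z 0 - w‖ + ‖w‖ := norm_add_le _ _
      _ ≤ V + ‖w‖ := by linarith [hdist 0 (Nat.zero_le _)]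
      _ = ‖w‖ + V := add_comm _ _
  have hroot : xiSq (z 0) = 0 := by simpa using hzero 0 (Nat.zero_le _)
  set y : ℝ := (z 0).im with hy
  have hy0 : 0 < y := hpos 0 (Nat.zero_le _)
  have hy1 : y ≤ Real.sqrt (‖w‖ + V) := by
    have h1 : |(z 0).im| ≤ Real.sqrt ‖z 0‖ := abs_im_le_sqrt_norm_of_xiSq_eq_zero hroot
    rw [abs_of_pos hy0] at h1
    exact h1.trans (Real.sqrt_le_sqrt hnorm0)
  have hy2 : y ^ 2 ≤ ‖w‖ + s * y := by
    have h1 : y ^ 2 ≤ ‖w‖ + V := by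
      calc y ^ 2 ≤ Real.sqrt (‖w‖ + V) ^ 2 := pow_le_pow_left₀ hy0.le hy1 2
        _ = ‖w‖ + V := Real.sq_sqrt (by positivity)
    have h2 : V ≤ s * y := by rw [hs, mul_comm]; exact hVle
    linarith
  have hy3 : y ≤ s + Real.sqrt ‖w‖ := le_add_sqrt_of_sq_le hs0 (norm_nonneg w) hy2
  refine ⟨z k, hzero k hk, hpos k hk, ?_⟩
  calc ‖z k - w‖ ≤ V := hdist k hk
    _ ≤ y * s := by rw [hs]; exact hVle
    _ ≤ (s + Real.sqrt ‖w‖) * s := mul_le_mul_of_nonneg_right hy3 hs0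
    _ = s * (s + Real.sqrt ‖w‖) := mul_comm _ _

/-- **Non-real ancestor at level `k` (both half-planes).** A zero `w` of `ξ₁⁽ⁿ⁾` with `Im w ≠ 0`
has, for every `k ≤ n`, an ancestor zero `v` of `ξ₁⁽ᵏ⁾` with `Im v ≠ 0` and
`‖v − w‖ ≤ (1 + √n)(1 + √n + √‖w‖)`: NON-REALNESS PROPAGATES DOWN THE DERIVATIVE ORDER at fixed
modulus up to that fuzz. RH-FREE. -/
theorem exists_nonreal_ancestor (n k : ℕ) (hk : k ≤ n) {w : ℂ}
    (hw : iteratedDeriv n xiSq w = 0) (him : w.im ≠ 0) :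
    ∃ v : ℂ, iteratedDeriv k xiSq v = 0 ∧ v.im ≠ 0 ∧
      ‖v - w‖ ≤ (1 + Real.sqrt n) * (1 + Real.sqrt n + Real.sqrt ‖w‖) := by
  -- Schwarz reflection for every derivative of the real entire function `ξ₁` (tree, by name)
  have hrefl : ∀ (m : ℕ) (u : ℂ), iteratedDeriv m xiSq (conj u) = conj (iteratedDeriv m xiSq u) :=
    fun m u => apply_conj_eq_conj (differentiable_iteratedDeriv_of_entire differentiable_xiSq m)
      (im_iteratedDeriv_ofReal differentiable_xiSq im_xiSq_ofReal m) u
  rcases lt_or_gt_of_ne him with hneg | hposw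
  · obtain ⟨v, hv, hvim, hvw⟩ := exists_ancestor_of_im_pos n k hk (w := conj w)
      (by rw [hrefl, hw, map_zero]) (by simpa using hneg)
    refine ⟨conj v, by rw [hrefl, hv, map_zero], by simpa using hvim.ne', ?_⟩
    have h1 : conj v - w = conj (v - conj w) := by simp [map_sub]
    rw [h1, Complex.norm_conj]
    simpa [Complex.norm_conj] using hvw
  · obtain ⟨v, hv, hvim, hvw⟩ := exists_ancestor_of_im_pos n k hk hw hposw
    exact ⟨v, hv, hvim.ne', hvw⟩

/-- **Realness climbs the ladder (window form).** If for some `k ≤ n` every zero of `ξ₁⁽ᵏ⁾` whose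
modulus lies in `[‖w‖ − Δ, ‖w‖ + Δ]`, `Δ = (1 + √n)(1 + √n + √‖w‖)`, is real, then the zero `w` of
`ξ₁⁽ⁿ⁾` is real. RH-FREE. -/
theorem im_eq_zero_of_level_real (n k : ℕ) (hk : k ≤ n) {w : ℂ} (hw : iteratedDeriv n xiSq w = 0)
    (hreal : ∀ v : ℂ, iteratedDeriv k xiSq v = 0 →
      ‖w‖ - (1 + Real.sqrt n) * (1 + Real.sqrt n + Real.sqrt ‖w‖) ≤ ‖v‖ →
      ‖v‖ ≤ ‖w‖ + (1 + Real.sqrt n) * (1 + Real.sqrt n + Real.sqrt ‖w‖) → v.im = 0) :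
    w.im = 0 := by
  by_contra him
  obtain ⟨v, hv, hvim, hvw⟩ := exists_nonreal_ancestor n k hk hw him
  refine hvim (hreal v hv ?_ ?_)
  · have := norm_sub_norm_le w v
    rw [norm_sub_rev] at hvw
    linarith
  · have := norm_sub_norm_le v w
    linarith

/-! ### 2. The EDGE follows from the BAND at any single rate -/

/-- Eventual real-arithmetic facts used in `edgeReal_of_bandReal`. -/
theorem eventually_edgeOfBand_ineq {c : ℝ} (hc : 0 < c) (k₁ : ℕ) : ∀ᶠ n : ℕ in atTop,
    (k₁ : ℝ) ≤ 3 * Real.log n / c ∧ (3 : ℝ) ≤ 3 * Real.log n / c ∧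
    3 * Real.log n / c + 1 ≤ n ∧ 1 ≤ Real.log n ∧
    64 * (3 * Real.log n / c + 1) ^ 2 + (1 + Real.sqrt n) * (1 + Real.sqrt n + 8 * n)
      ≤ ((n : ℝ) / Real.log n) ^ 2 / 64 ∧
    64 * ((n : ℝ) / Real.log n) ^ 2 + (1 + Real.sqrt n) * (1 + Real.sqrt n + 8 * n)
      < (n : ℝ) ^ 3 := by
  have hlog : Tendsto (fun n : ℕ => Real.log (n : ℝ)) atTop atTop :=
    Real.tendsto_log_atTop.comp tendsto_natCast_atTop_atTop
  have E1 : ∀ᶠ n : ℕ in atTop, c * k₁ / 3 ≤ Real.log n := hlog.eventually_ge_atTop _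
  have E2 : ∀ᶠ n : ℕ in atTop, max c 1 ≤ Real.log n := hlog.eventually_ge_atTop _
  -- `log n ≤ (c/6) n`
  have E3 : ∀ᶠ n : ℕ in atTop, Real.log n ≤ c / 6 * (n : ℝ) := by
    have h := (Real.isLittleO_log_id_atTop.comp_tendsto tendsto_natCast_atTop_atTop).bound
      (show (0 : ℝ) < c / 6 by positivity)
    filter_upwards [h] with n hn
    have hn0 : (0 : ℝ) ≤ n := Nat.cast_nonneg n
    simp only [Function.comp, id, Real.norm_eq_abs, abs_of_nonneg hn0] at hn
    exact (le_abs_self _).trans hn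
  -- `(log n)^4 ≤ ε n` for the two values of `ε` we need
  set a : ℝ := 3 / c + 1 with ha
  have ha0 : 0 < a := by positivity
  have E4 : ∀ᶠ n : ℕ in atTop, Real.log n ^ 4 ≤ 1 / (8192 * a ^ 2) * (n : ℝ) := by
    have h := ((Real.isLittleO_pow_log_id_atTop (n := 4)).comp_tendsto
      tendsto_natCast_atTop_atTop).bound (show (0 : ℝ) < 1 / (8192 * a ^ 2) by positivity)
    filter_upwards [h] with n hn
    have hn0 : (0 : ℝ) ≤ n := Nat.cast_nonneg n
    simp only [Function.comp, id, Real.norm_eq_abs, abs_of_nonneg hn0] at hn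
    exact (le_abs_self _).trans hn
  have E5 : ∀ᶠ n : ℕ in atTop, Real.log n ^ 4 ≤ 1 / 2560 ^ 2 * (n : ℝ) := by
    have h := ((Real.isLittleO_pow_log_id_atTop (n := 4)).comp_tendsto
      tendsto_natCast_atTop_atTop).bound (show (0 : ℝ) < 1 / 2560 ^ 2 by positivity)
    filter_upwards [h] with n hn
    have hn0 : (0 : ℝ) ≤ n := Nat.cast_nonneg n
    simp only [Function.comp, id, Real.norm_eq_abs, abs_of_nonneg hn0] at hn
    exact (le_abs_self _).trans hn
  filter_upwards [E1, E2, E3, E4, E5, eventually_ge_atTop 85] with n h1 h2 h3 h4 h5 h85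
  have hn0 : (0 : ℝ) < n := by exact_mod_cast (by omega : 0 < n)
  have hn1 : (1 : ℝ) ≤ n := by exact_mod_cast (by omega : 1 ≤ n)
  have hn85 : (85 : ℝ) ≤ n := by exact_mod_cast h85
  set L : ℝ := Real.log n with hL
  have hL1 : 1 ≤ L := le_trans (le_max_right _ _) h2
  have hLc : c ≤ L := le_trans (le_max_left _ _) h2
  have hL0 : 0 < L := by linarith
  have hsq : Real.sqrt (n : ℝ) ^ 2 = n := Real.sq_sqrt hn0.le
  have hsqrt1 : 1 ≤ Real.sqrt (n : ℝ) := by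
    rw [show (1 : ℝ) = Real.sqrt 1 by simp]; exact Real.sqrt_le_sqrt hn1
  have hsqrtn : Real.sqrt (n : ℝ) ≤ n := by nlinarith
  -- the fuzz `Δ₀ = (1+√n)(1+√n+8n) ≤ 20 n √n`
  have hΔ : (1 + Real.sqrt n) * (1 + Real.sqrt n + 8 * n) ≤ 20 * n * Real.sqrt n := by
    nlinarith
  refine ⟨?_, ?_, ?_, hL1, ?_, ?_⟩
  · rw [le_div_iff₀ hc]; linarith
  · rw [le_div_iff₀ hc]; linarith
  · have : 3 * L / c ≤ (n : ℝ) / 2 := by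
      rw [div_le_iff₀ hc]
      have := mul_le_mul_of_nonneg_left h3 (by norm_num : (0 : ℝ) ≤ 3)
      nlinarith
    linarith
  · -- key lower inequality: `64 (3L/c+1)² + Δ₀ ≤ (n/L)²/64`
    have hX : ((n : ℝ) / L) ^ 2 / 64 = (n : ℝ) ^ 2 / (64 * L ^ 2) := by
      rw [div_pow]; field_simp
    rw [hX, le_div_iff₀ (by positivity)]
    -- term A: `64·64 (3L/c+1)² L² ≤ n²/2`
    have hA1 : 3 * L / c + 1 ≤ a * L := by
      have : a * L = 3 * L / c + L := by rw [ha]; ring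
      rw [this]; linarith
    have hA2 : (3 * L / c + 1) ^ 2 ≤ a ^ 2 * L ^ 2 := by
      rw [← mul_pow]
      exact pow_le_pow_left₀ (by positivity) hA1 2
    have hA3 : 8192 * a ^ 2 * L ^ 4 ≤ (n : ℝ) := by
      have := mul_le_mul_of_nonneg_left h4 (show (0 : ℝ) ≤ 8192 * a ^ 2 by positivity)
      rwa [← mul_assoc, show 8192 * a ^ 2 * (1 / (8192 * a ^ 2)) = (1 : ℝ) by field_simp,
        one_mul] at this
    have hA : 64 * (3 * L / c + 1) ^ 2 * (64 * L ^ 2) ≤ (n : ℝ) ^ 2 / 2 := by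
      have hnn : (n : ℝ) ≤ (n : ℝ) ^ 2 := by nlinarith
      calc 64 * (3 * L / c + 1) ^ 2 * (64 * L ^ 2) = 4096 * ((3 * L / c + 1) ^ 2 * L ^ 2) := by ring
        _ ≤ 4096 * (a ^ 2 * L ^ 2 * L ^ 2) :=
          mul_le_mul_of_nonneg_left (mul_le_mul_of_nonneg_right hA2 (by positivity)) (by norm_num)
        _ = (8192 * a ^ 2 * L ^ 4) / 2 := by ring
        _ ≤ (n : ℝ) / 2 := by linarith [hA3]
        _ ≤ (n : ℝ) ^ 2 / 2 := by linarith [hnn]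
    -- term B: `Δ₀ · 64 L² ≤ n²/2`, from `2560 L² ≤ √n`
    have hB1 : L ^ 2 ≤ Real.sqrt n / 2560 := by
      have h : L ^ 4 ≤ (Real.sqrt n / 2560) ^ 2 := by
        rw [div_pow, hsq]; linarith
      have := Real.sqrt_le_sqrt h
      rwa [show L ^ 4 = (L ^ 2) ^ 2 by ring, Real.sqrt_sq (by positivity),
        Real.sqrt_sq (by positivity)] at this
    have hB : (1 + Real.sqrt n) * (1 + Real.sqrt n + 8 * n) * (64 * L ^ 2) ≤ (n : ℝ) ^ 2 / 2 := by
      calc (1 + Real.sqrt n) * (1 + Real.sqrt n + 8 * n) * (64 * L ^ 2)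
          ≤ 20 * n * Real.sqrt n * (64 * (Real.sqrt n / 2560)) := by
            apply mul_le_mul hΔ (by linarith) (by positivity) (by positivity)
        _ = (n : ℝ) ^ 2 / 2 := by
            have hss : Real.sqrt (n : ℝ) * Real.sqrt n = n := by rw [← sq, hsq]
            calc 20 * (n : ℝ) * Real.sqrt n * (64 * (Real.sqrt n / 2560))
                = 1 / 2 * n * (Real.sqrt n * Real.sqrt n) := by ring
              _ = (n : ℝ) ^ 2 / 2 := by rw [hss]; ring
    rw [add_mul]
    linarith [hA, hB]
  · -- upper inequality: `64 (n/L)² + Δ₀ < n³`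
    have hX1 : ((n : ℝ) / L) ^ 2 ≤ (n : ℝ) ^ 2 :=
      pow_le_pow_left₀ (by positivity) (div_le_self hn0.le hL1) 2
    have h20 : 20 * n * Real.sqrt n ≤ 20 * (n : ℝ) ^ 2 := by nlinarith
    have hcube : 85 * (n : ℝ) ^ 2 ≤ (n : ℝ) ^ 3 := by nlinarith [sq_nonneg (n : ℝ)]
    have hpos2 : (0 : ℝ) < (n : ℝ) ^ 2 := by positivity
    linarith [hX1, h20, hΔ]

/-- **The BAND at one rate implies the EDGE (RH-FREE).** If for some `c > 0` and all `k ≥ k₁` every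
zero of `ξ₁⁽ᵏ⁾` with `64(k/log k)² ≤ ‖z‖ < e^{ck}` is real, then from some `n₁` on every zero of
`ξ₁⁽ⁿ⁾` with `(n/log n)²/64 ≤ ‖z‖ ≤ 64(n/log n)²` is real. Proof: a non-real such zero has a non-real
ancestor at level `k = ⌈3 log n/c⌉` (`exists_nonreal_ancestor`) whose modulus lies in
`[‖z‖ − Δ₀, ‖z‖ + Δ₀] ⊆ [64 k², n³) ⊆ [64(k/log k)², e^{ck})`, `Δ₀ = (1+√n)(1+√n+8n)`. -/
theorem edgeReal_of_bandReal {c : ℝ} (hc : 0 < c) {k₁ : ℕ}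
    (hB : ∀ k : ℕ, k₁ ≤ k → ∀ z : ℂ, iteratedDeriv k xiSq z = 0 →
      64 * ((k : ℝ) / Real.log k) ^ 2 ≤ ‖z‖ → ‖z‖ < Real.exp (c * (k : ℝ)) → z.im = 0) :
    ∃ n₁ : ℕ, ∀ n : ℕ, n₁ ≤ n → ∀ z : ℂ, iteratedDeriv n xiSq z = 0 →
      chainRadius n ≤ ‖z‖ → ‖z‖ ≤ 64 * ((n : ℝ) / Real.log n) ^ 2 → z.im = 0 := by
  obtain ⟨n₁, hn₁⟩ := Filter.eventually_atTop.1 (eventually_edgeOfBand_ineq hc k₁)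
  refine ⟨n₁, fun n hn z hz hlo hhi => ?_⟩
  obtain ⟨h1, h2, h3, hL1, h4, h5⟩ := hn₁ n hn
  have hn0 : (0 : ℝ) < n := by
    have : (0 : ℝ) < Real.log n := by linarith
    by_contra h
    rw [not_lt] at h
    have : (n : ℝ) = 0 := le_antisymm h (Nat.cast_nonneg n)
    rw [this, Real.log_zero] at hL1
    linarith
  set L : ℝ := Real.log n with hL
  have hL0 : 0 < L := by linarith
  -- the level `k = ⌈3 L / c⌉`
  set k : ℕ := ⌈3 * L / c⌉₊ with hk
  have hk0 : (0 : ℝ) ≤ 3 * L / c := by positivity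
  have hkge : 3 * L / c ≤ (k : ℝ) := Nat.le_ceil _
  have hklt : (k : ℝ) < 3 * L / c + 1 := Nat.ceil_lt_add_one hk0
  have hk₁ : k₁ ≤ k := by exact_mod_cast h1.trans hkge
  have hk3 : (3 : ℝ) ≤ k := h2.trans hkge
  have hkn : k ≤ n := by
    have : (k : ℝ) < n := lt_of_lt_of_le hklt h3
    exact_mod_cast this.le
  -- `log k ≥ 1`, so `64 (k/log k)² ≤ 64 k² ≤ 64 (3L/c + 1)²`
  have hkpos : (0 : ℝ) < k := by linarith
  have hlogk : 1 ≤ Real.log (k : ℝ) := by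
    rw [Real.le_log_iff_exp_le hkpos]
    linarith [Real.exp_one_lt_d9]
  have hkk : 64 * ((k : ℝ) / Real.log k) ^ 2 ≤ 64 * (3 * L / c + 1) ^ 2 := by
    have h1' : (k : ℝ) / Real.log k ≤ k := div_le_self hkpos.le hlogk
    have h2' : ((k : ℝ) / Real.log k) ^ 2 ≤ (3 * L / c + 1) ^ 2 :=
      pow_le_pow_left₀ (by positivity) (h1'.trans hklt.le) 2
    linarith
  -- `exp (c k) ≥ n³`
  have hexp : (n : ℝ) ^ 3 ≤ Real.exp (c * (k : ℝ)) := by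
    have h3L : 3 * L ≤ c * (k : ℝ) := by
      have := mul_le_mul_of_nonneg_left hkge hc.le
      rwa [show c * (3 * L / c) = 3 * L by field_simp] at this
    calc (n : ℝ) ^ 3 = Real.exp (3 * L) := by
          rw [hL, show (3 : ℝ) * Real.log n = Real.log ((n : ℝ) ^ 3) by
            rw [Real.log_pow]; norm_num, Real.exp_log (by positivity)]
      _ ≤ Real.exp (c * (k : ℝ)) := Real.exp_le_exp.2 h3L
  -- the fuzz at `w = z`: `√‖z‖ ≤ 8 n / L ≤ 8 n`
  have hsz : Real.sqrt ‖z‖ ≤ 8 * n := by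
    have hx : 0 ≤ (n : ℝ) / L := by positivity
    calc Real.sqrt ‖z‖ ≤ Real.sqrt (64 * ((n : ℝ) / L) ^ 2) := Real.sqrt_le_sqrt hhi
      _ = 8 * ((n : ℝ) / L) := by
          rw [show (64 : ℝ) * ((n : ℝ) / L) ^ 2 = (8 * ((n : ℝ) / L)) ^ 2 by ring,
            Real.sqrt_sq (by positivity)]
      _ ≤ 8 * n := by nlinarith [div_le_self hn0.le hL1]
  have hΔ : (1 + Real.sqrt n) * (1 + Real.sqrt n + Real.sqrt ‖z‖)
      ≤ (1 + Real.sqrt n) * (1 + Real.sqrt n + 8 * n) :=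
    mul_le_mul_of_nonneg_left (by linarith) (by positivity)
  have hlo' : ((n : ℝ) / L) ^ 2 / 64 ≤ ‖z‖ := by
    have : chainRadius n = ((n : ℝ) / L) ^ 2 / 64 := rfl
    linarith
  -- apply the window form at level `k`
  refine im_eq_zero_of_level_real n k hkn hz fun v hv hvlo hvhi => hB k hk₁ v hv ?_ ?_
  · linarith
  · linarith

end Summit.RiemannHypothesis.RiemannHypothesis.Theorems.JensenPolynomials.LogBand.RealnessLadder

end
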